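import Summits.PneNP.PneNP.Theorems.PhaseTwinsPolyDepthTwinsAboveConnectorDecomp
import Summits.PneNP.PneNP.Theorems.PhaseTwinsPolyDepthTwinsAboveConnectorExpect

/-!
# Route PhaseTwins, crux `PolyDepthTwinsAbove` (stmt-PneNP-2719), line `parity-wired-ports`:
# `stub_connector` — Sly's Lemma 2.2 for the parity wiring

The registered stub `stub_connector` of the line skeleton: there is `n₀(θ, ε)` such that for `n ≥ n₀`
every gadget with `(GpropA)` at `n` and `(GpropB)` with `δ = n^{-2θ}`, wired over any base with
`6M ≤ n^{θ/4}`, satisfies `PWCutEstimate` with relative error `ε` for every charge vector: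
`(phaseProbs)` `Z_{base}(Y) ≥ n^{-6M} Z_{base}` — the copies are independent on `pwBase`
(`hardcoreZOn_pwBase_phase`) and each phase has probability `≥ 1/n` (`SlyPropA`); `(cutProb)`
`|Z_{pwGraph c}(Y) − pwW c Y · Z_{base}(Y)| ≤ ε pwW c Y Z_{base}(Y)` — group by port configurations
(`hardcoreZOn_pwGraph_phase_eq_sum`), compare each family with the product measures termwise
(`SlyPropB`, factors `(1 ± δ)^{6M}`), evaluate the product-measure expectation exactly
(`sum_pwPatFactor_portLaw`), and use `(1 ± n^{-2θ})^{6M} = 1 ± ε` for `6M ≤ n^{θ/4}`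
(`SlyReduction.eventually_pow_error_le`). This is the tree's `slyCutEstimate_of_slyProps` for the new
wiring. [cite: Sly2010, Lemma 2.2 (§2.2); GalanisStefankovicVigoda2016, §6.3]
-/

noncomputable section

open scoped Classical BigOperators

namespace Summit.PneNP.PneNP.Cruxes.PolyDepthTwinsAbove.ParityWiredPorts

open Finset
open Literature.Computability.Complexity (hardcoreZOn hardcoreZOn_def hardcoreZOn_nonneg slyPhase
  portPattern portLaw portLaw_nonneg SlyPropA SlyPropB sum_hardcoreZOn_fiber le_and_le_of_abs_sub_le
  SlyReduction.eventually_pow_error_le)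
open Literature.Computability.Complexity.Expander (RotGraph)
open Literature.ModelTheory.FiniteModelTheory.TseitinColouring (Dart)
open Literature.ModelTheory.FiniteModelTheory.CFIMatching (Canon)
open Literature.Probability.LatticeModels (independencePolynomial independencePolynomial_pos)

set_option linter.dupNamespace false

variable {M v m κ₁ κ₂ : ℕ}

/-! ## Nonnegativity -/

/-- The local factor is nonnegative for `λ ≥ 0` and nonnegative vacancies. -/
theorem cxWeight_nonneg (e : ZMod 2) {lam : ℝ} (hlam : 0 ≤ lam) {x : Fin 3 × ZMod 2 → ℝ}
    (hx : ∀ p, 0 ≤ x p) : 0 ≤ cxWeight e lam x := by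
  unfold cxWeight
  refine sum_nonneg fun J _ => ?_
  split_ifs
  · exact mul_nonneg (pow_nonneg hlam _) (prod_nonneg fun p _ => by split_ifs <;> [exact hx p; exact zero_le_one])
  · exact le_rfl

/-- The pattern factor is nonnegative for `λ ≥ 0`. -/
theorem pwPatFactor_nonneg (R : RotGraph M 3) (W : Wiring v m κ₁ κ₂) {lam : ℝ} (hlam : 0 ≤ lam)
    (c : Fin M → ZMod 2) (P : Dart M 3 × ZMod 2 → Finset (Fin m) × Finset (Fin m)) :
    0 ≤ pwPatFactor R W lam c P := by
  unfold pwPatFactor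
  refine mul_nonneg (by split_ifs <;> norm_num) (prod_nonneg fun k _ => cxWeight_nonneg _ hlam fun p => ?_)
  split_ifs <;> norm_num

/-- The weights are nonnegative (`λ ≥ 0`, `q± ∈ [0, 1]`). -/
theorem pwW_nonneg (R : RotGraph M 3) {lam qp qm : ℝ} (hlam : 0 ≤ lam) (hqm0 : 0 ≤ qm) (hqm1 : qm ≤ 1)
    (hqp0 : 0 ≤ qp) (hqp1 : qp ≤ 1) (κ₁ κ₂ : ℕ) (c : Fin M → ZMod 2) (Y : Dart M 3 × ZMod 2 → Bool) :
    0 ≤ pwW R lam qp qm κ₁ κ₂ c Y := by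
  have hocc : ∀ s, 0 ≤ occP qp qm s ∧ occP qp qm s ≤ 1 ∧ 0 ≤ occM qp qm s ∧ occM qp qm s ≤ 1 := by
    intro s; cases s <;> simp [occP, occM] <;> refine ⟨?_, ?_, ?_, ?_⟩ <;> assumption
  unfold pwW
  refine mul_nonneg (Finset.prod_nonneg fun δ _ => ?_) (Finset.prod_nonneg fun w _ => pow_nonneg ?_ _)
  · split_ifs
    · unfold pairW
      refine pow_nonneg (mul_nonneg ?_ ?_) _
      · obtain ⟨h1, h2, -, -⟩ := hocc (Y (δ, 0))
        obtain ⟨h3, h4, -, -⟩ := hocc (Y (δ, 1))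
        nlinarith [mul_le_one₀ h2 h3 h4]
      · obtain ⟨-, -, h1, h2⟩ := hocc (Y (δ, 0))
        obtain ⟨-, -, h3, h4⟩ := hocc (Y (δ, 1))
        nlinarith [mul_le_one₀ h2 h3 h4]
    · exact zero_le_one
  · unfold cxW
    refine div_nonneg (cxWeight_nonneg _ hlam fun p => ?_) (pow_nonneg (by linarith) _)
    obtain ⟨-, h2, -, -⟩ := hocc (Y ((canonEnd R (w, p.1)).1, p.2))
    linarith

/-! ## `(cutProb)` with explicit error -/

/-- **`(cutProb)` for the parity wiring with explicit error.** If the gadget satisfies `(GpropB)` with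
error `δ ∈ [0,1]`, then for every charge vector and phase vector
`(1-δ)^{6M} · pwW c Y · Z_{base}(Y) ≤ Z_{pwGraph c}(Y) ≤ (1+δ)^{6M} · pwW c Y · Z_{base}(Y)`. -/
theorem cutProb_bounds_pw (R : RotGraph M 3) (W : Wiring v m κ₁ κ₂) {lam : ℝ} (hlam : 0 ≤ lam)
    (c : Fin M → ZMod 2) {qp qm δ : ℝ} (hqm : 0 < qm) (hlt : qm < qp) (hqp : qp < 1) (hδ1 : δ ≤ 1)
    (hB : SlyPropB W.G lam W.Wp W.Wm W.Vp W.Vm qp qm δ) (Y : Dart M 3 × ZMod 2 → Bool) :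
    (1 - δ) ^ Fintype.card (Dart M 3 × ZMod 2) *
        (pwW R lam qp qm κ₁ κ₂ c Y * hardcoreZOn (pwBase M κ₂ W) lam (fun I => pwPhase W I = Y)) ≤
      hardcoreZOn (pwGraph R W c) lam (fun I => pwPhase W I = Y) ∧
    hardcoreZOn (pwGraph R W c) lam (fun I => pwPhase W I = Y) ≤
      (1 + δ) ^ Fintype.card (Dart M 3 × ZMod 2) *
        (pwW R lam qp qm κ₁ κ₂ c Y * hardcoreZOn (pwBase M κ₂ W) lam (fun I => pwPhase W I = Y)) := by
  -- the reference quantity, as a sum over pattern families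
  have href : pwW R lam qp qm κ₁ κ₂ c Y * hardcoreZOn (pwBase M κ₂ W) lam (fun I => pwPhase W I = Y) =
      ∑ P : Dart M 3 × ZMod 2 → Finset (Fin m) × Finset (Fin m),
        pwPatFactor R W lam c P *
          ∏ g : Dart M 3 × ZMod 2, (portLaw (if Y g then qp else qm) (if Y g then qm else qp) m (P g) *
            hardcoreZOn W.G lam (fun S => slyPhase W.Wp W.Wm S = Y g)) := by
    rw [hardcoreZOn_pwBase_phase, ← mul_assoc, ← sum_pwPatFactor_portLaw R W hlam qp qm c Y, sum_mul]
    refine sum_congr rfl fun P _ => ?_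
    rw [prod_mul_distrib, mul_assoc]
  rw [href, hardcoreZOn_pwGraph_phase_eq_sum, mul_sum, mul_sum]
  -- the termwise comparison supplied by `(GpropB)`
  have hterm : ∀ (g : Dart M 3 × ZMod 2) (P : Dart M 3 × ZMod 2 → Finset (Fin m) × Finset (Fin m)),
      (1 - δ) * (portLaw (if Y g then qp else qm) (if Y g then qm else qp) m (P g) *
          hardcoreZOn W.G lam (fun S => slyPhase W.Wp W.Wm S = Y g)) ≤
        hardcoreZOn W.G lam (fun S => slyPhase W.Wp W.Wm S = Y g ∧ portPattern W.Vp W.Vm S = P g) ∧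
      hardcoreZOn W.G lam (fun S => slyPhase W.Wp W.Wm S = Y g ∧ portPattern W.Vp W.Vm S = P g) ≤
        (1 + δ) * (portLaw (if Y g then qp else qm) (if Y g then qm else qp) m (P g) *
          hardcoreZOn W.G lam (fun S => slyPhase W.Wp W.Wm S = Y g)) :=
    fun g P => le_and_le_of_abs_sub_le (hB (Y g) (P g))
  have hQ : ∀ (g : Dart M 3 × ZMod 2) (P : Dart M 3 × ZMod 2 → Finset (Fin m) × Finset (Fin m)),
      0 ≤ portLaw (if Y g then qp else qm) (if Y g then qm else qp) m (P g) := by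
    intro g P
    cases Y g
    · exact portLaw_nonneg hqm.le (hlt.le.trans hqp.le) (hqm.le.trans hlt.le) hqp.le m (P g)
    · exact portLaw_nonneg (hqm.le.trans hlt.le) hqp.le hqm.le (hlt.le.trans hqp.le) m (P g)
  have hZ : ∀ g : Dart M 3 × ZMod 2, 0 ≤ hardcoreZOn W.G lam (fun S => slyPhase W.Wp W.Wm S = Y g) :=
    fun g => hardcoreZOn_nonneg _ hlam _
  have hF : ∀ P, 0 ≤ pwPatFactor R W lam c P := pwPatFactor_nonneg R W hlam c
  constructor
  · refine sum_le_sum fun P _ => ?_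
    rw [← mul_assoc, mul_comm ((1 - δ) ^ _), mul_assoc]
    refine mul_le_mul_of_nonneg_left ?_ (hF P)
    rw [show ((1 : ℝ) - δ) ^ Fintype.card (Dart M 3 × ZMod 2) = ∏ _g : Dart M 3 × ZMod 2, (1 - δ) by simp,
      ← prod_mul_distrib]
    refine prod_le_prod (fun g _ => ?_) fun g _ => ?_
    · exact mul_nonneg (by linarith) (mul_nonneg (hQ g P) (hZ g))
    · exact (hterm g P).1
  · refine sum_le_sum fun P _ => ?_
    rw [← mul_assoc, mul_comm ((1 + δ) ^ _), mul_assoc]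
    refine mul_le_mul_of_nonneg_left ?_ (hF P)
    rw [show ((1 : ℝ) + δ) ^ Fintype.card (Dart M 3 × ZMod 2) = ∏ _g : Dart M 3 × ZMod 2, (1 + δ) by simp,
      ← prod_mul_distrib]
    refine prod_le_prod (fun g _ => hardcoreZOn_nonneg _ hlam _) fun g _ => ?_
    exact (hterm g P).2

/-! ## `(phaseProbs)` -/

/-- The number of gadget copies is `6M`. -/
theorem card_copies (M : ℕ) : Fintype.card (Dart M 3 × ZMod 2) = 6 * M := by
  simp only [Fintype.card_prod, Fintype.card_fin, ZMod.card]
  ring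

/-- **`Z(pwBase) = (1+λ)^{10Mκ₂} · Z_G^{6M}`**: the partition function of the disjoint copies with the
isolated complex vertices. -/
theorem independencePolynomial_pwBase (W : Wiring v m κ₁ κ₂) (lam : ℝ) :
    independencePolynomial (pwBase M κ₂ W) lam =
      (1 + lam) ^ Fintype.card ((Fin M × Fin 3 × ZMod 2 × Fin κ₂) ⊕ (Fin M × (Fin 2 → ZMod 2) × Fin κ₂)) *
        independencePolynomial W.G lam ^ Fintype.card (Dart M 3 × ZMod 2) := by
  rw [← sum_hardcoreZOn_fiber (pwBase M κ₂ W) lam (pwPhase W)]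
  simp_rw [hardcoreZOn_pwBase_phase]
  rw [← mul_sum]
  congr 1
  have h : ∏ _g : Dart M 3 × ZMod 2, (∑ b : Bool, hardcoreZOn W.G lam (fun S => slyPhase W.Wp W.Wm S = b)) =
      ∑ Y : Dart M 3 × ZMod 2 → Bool, ∏ g, hardcoreZOn W.G lam (fun S => slyPhase W.Wp W.Wm S = Y g) :=
    Fintype.prod_sum _
  rw [← h, prod_congr rfl fun g _ => sum_hardcoreZOn_fiber W.G lam (slyPhase W.Wp W.Wm), prod_const,
    card_univ]

/-- **`(phaseProbs)` for the parity wiring**: `Z_{base}(Y) ≥ Z(pwBase)/n^{6M}` from `(GpropA)`. -/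
theorem phaseProbs_pw (W : Wiring v m κ₁ κ₂) {lam : ℝ} (hlam : 0 ≤ lam) {n : ℕ}
    (hA : SlyPropA W.G lam W.Wp W.Wm n) (Y : Dart M 3 × ZMod 2 → Bool) :
    ((n : ℝ) ^ (6 * M))⁻¹ * independencePolynomial (pwBase M κ₂ W) lam ≤
      hardcoreZOn (pwBase M κ₂ W) lam (fun I => pwPhase W I = Y) := by
  rw [independencePolynomial_pwBase, hardcoreZOn_pwBase_phase, card_copies, ← mul_assoc,
    mul_comm (((n : ℝ) ^ (6 * M))⁻¹), mul_assoc]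
  refine mul_le_mul_of_nonneg_left ?_ (pow_nonneg (by linarith) _)
  calc ((n : ℝ) ^ (6 * M))⁻¹ * independencePolynomial W.G lam ^ (6 * M)
      = (independencePolynomial W.G lam / n) ^ (6 * M) := by rw [div_pow, div_eq_inv_mul]
    _ = ∏ _g : Dart M 3 × ZMod 2, independencePolynomial W.G lam / n := by
        rw [prod_const, card_univ, card_copies]
    _ ≤ ∏ g, hardcoreZOn W.G lam (fun S => slyPhase W.Wp W.Wm S = Y g) :=
        prod_le_prod (fun g _ => div_nonneg (independencePolynomial_pos W.G hlam).le n.cast_nonneg)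
          fun g _ => by
            cases Y g
            · exact hA.2
            · exact hA.1

/-! ## The stub -/

/-- **S5 — Sly's Lemma 2.2 for the parity wiring** (registered stub `stub_connector` of the line
`parity-wired-ports`). -/
theorem stub_connector {θ ε qp qm : ℝ} (hθ : 0 < θ) (hε : 0 < ε) (hqm : 0 < qm) (hlt : qm < qp)
    (hqp : qp < 1) :
    ∃ n₀ : ℕ, ∀ n : ℕ, n₀ ≤ n → ∀ {M v m κ₁ κ₂ : ℕ} (R : RotGraph M 3) (W : Wiring v m κ₁ κ₂) {lam : ℝ},
      0 ≤ lam → (6 * M : ℝ) ≤ (n : ℝ) ^ (θ / 4) →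
        SlyPropA W.G lam W.Wp W.Wm n → SlyPropB W.G lam W.Wp W.Wm W.Vp W.Vm qp qm ((n : ℝ) ^ (-(2 * θ))) →
          ∀ c : Fin M → ZMod 2, PWCutEstimate R W lam qp qm ε n c := by
  obtain ⟨n₀, hn₀⟩ := SlyReduction.eventually_pow_error_le hθ hε
  refine ⟨n₀, fun n hn M v m κ₁ κ₂ R W lam hlam hM hA hB c Y => ?_⟩
  obtain ⟨hnpos, hδ1, herr⟩ := hn₀ n hn
  have hN : ((Fintype.card (Dart M 3 × ZMod 2) : ℕ) : ℝ) ≤ (n : ℝ) ^ (θ / 4) := by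
    rw [card_copies]; push_cast; exact hM
  obtain ⟨hlo, hhi⟩ := herr _ hN
  refine ⟨phaseProbs_pw W hlam hA Y, ?_⟩
  obtain ⟨h1, h2⟩ := cutProb_bounds_pw R W hlam c hqm hlt hqp hδ1 hB Y
  have hX : 0 ≤ pwW R lam qp qm κ₁ κ₂ c Y * hardcoreZOn (pwBase M κ₂ W) lam (fun I => pwPhase W I = Y) :=
    mul_nonneg (pwW_nonneg R hlam hqm.le (hlt.le.trans hqp.le) (hqm.le.trans hlt.le) hqp.le κ₁ κ₂ c Y)
      (hardcoreZOn_nonneg _ hlam _)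
  rw [abs_sub_le_iff]
  constructor <;> nlinarith [mul_le_mul_of_nonneg_right hlo hX, mul_le_mul_of_nonneg_right hhi hX]

end Summit.PneNP.PneNP.Cruxes.PolyDepthTwinsAbove.ParityWiredPorts
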